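import Mathlib
import Literature.Analysis.FluidPDE.VorticityEquation
import Literature.Analysis.FluidPDE.AxisymmetricVorticityTransport
import Literature.Analysis.FluidPDE.TaoLocalisationHolds
import Literature.Analysis.FluidPDE.AxisymQuotientRayAverage
import Literature.Analysis.FluidPDE.NSVorticityBKMProofs
import Literature.Analysis.FluidPDE.EnstrophySplitting
import Literature.Analysis.FluidPDE.LipschitzSqIntegrableDecay
import Literature.Analysis.FluidPDE.ParabolicComparison
import Literature.Analysis.FluidPDE.LerayProfileCalculus
import Literature.Analysis.FluidPDE.ConstantinDirectionDissipationProofs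
import Literature.Analysis.FluidPDE.ConstantinDirectionDissipationCalculus
import Literature.Analysis.FluidPDE.BeiraoDaVeigaVorticityCriterion
import HarnessLib

/-!
# Tools for `RossbyDichotomy.StretchingAtMaxCriterion` (item stmt-NavierStokesRegularity-2923)

For a classical Navier–Stokes solution `(u, p)` on `ℝ³ × [0, T)` (`ν > 0`), Leray–Hopf from a
rapidly decaying datum, `ω = curl u`:

* `slab_bounds` — on every closed sub-slab `[0, T'] × ℝ³`, `T' < T`: `‖ω‖ ≤ W`, `‖∂ₜω‖ ≤ L`
  (Tao's class `tao2011_hasBoundedSobolevNormsOn_holds` + Sobolev imbedding + the vorticity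
  equation), and each slice `ω(t, ·)` is square integrable;
* `tendsto_curl_cocompact` / `exists_argmax_curl` — `ω(t, ·) → 0` at infinity, so `‖ω(t, ·)‖` attains
  its maximum;
* `deriv_normSq_curl_le_at_argmax` — at a spatial maximiser `x*` of `‖ω(t, ·)‖`, `t ∈ (0, T)`,
  `s ↦ ‖ω(s, x*)‖²` is differentiable at `t` with derivative `≤ 2 ⟪ω, Du ω⟫(t, x*)`
  (`⟪ω, (u·∇)ω⟫ = ½ u·∇‖ω‖² = 0` and `ν⟪ω, Δω⟫ ≤ −ν|∇ω|² ≤ 0` at a maximum of `‖ω‖²`);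
* `hasSmoothExtensionPast_of_curl_bounded` — a uniform bound `‖ω‖ ≤ K` on `[0, T) × ℝ³` continues the
  solution past `T`: `ω ∈ L^{5/2}_{t,x}` (`‖ω‖^{5/2} ≤ K^{1/2}‖ω‖² ≤ 2K^{1/2}|∇u|²` and the
  Leray–Hopf dissipation bound), then the tree's UNCONDITIONAL Beirão da Veiga vorticity criterion
  `BeiraoDaVeiga1995_vorticityCriterion` with `2/q + 3/r = 2`, `q = r = 5/2`.

HONEST FRAMING: bookkeeping about HYPOTHETICAL smooth solutions up to a putative singular time;
nothing here bears on the regularity problem itself.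
-/

noncomputable section

set_option linter.dupNamespace false

namespace Summit.NavierStokesRegularity.NavierStokesRegularity.Theorems

namespace StretchingAtMax

open MeasureTheory Set Function Filter Topology Metric InnerProductSpace Literature.Analysis.FluidPDE
open scoped RealInnerProductSpace NNReal ENNReal ContDiff Laplacian

variable {ν T : ℝ} {u : ℝ → EuclideanSpace ℝ (Fin 3) → EuclideanSpace ℝ (Fin 3)}
  {p : ℝ → EuclideanSpace ℝ (Fin 3) → ℝ}

/-! ### Sub-slab bounds from Tao's class -/

/-- **Tao's class on closed sub-slabs**: a classical Leray–Hopf solution from a rapidly decaying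
datum has all `L²` Sobolev norms bounded on `[0, T']`, `0 < T' < T`.
[cite: Tao2011, Cor. 11.1 (arXiv Cor. 68)] -/
theorem hasBoundedSobolevNormsOn_Icc (hν : 0 < ν)
    (hsol : IsClassicalNSSolutionOn (Ico 0 T) ν 0 u p) (hLH : IsLerayHopfOn T ν 0 (u 0) u)
    (hdec : HasRapidSpatialDecay (u 0)) {T' : ℝ} (hT'0 : 0 < T') (hT' : T' < T) :
    HasBoundedSobolevNormsOn (Icc 0 T') u := by
  have hsolc : IsClassicalNSSolutionOn (Icc 0 T') ν 0 u p :=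
    hsol.mono (Icc_subset_Ico_right hT') (uniqueDiffOn_Icc hT'0)
  have hE : ∃ C : ℝ≥0, ∀ t ∈ Icc 0 T', ∫⁻ x, ‖u t x‖ₑ ^ 2 ≤ C :=
    ⟨(2 * VectorCalculus.kineticEnergy (u 0)).toNNReal, fun t ht =>
      hLH.lintegral_enorm_sq_le hν.le ⟨ht.1, ht.2.trans hT'.le⟩⟩
  exact tao2011_hasBoundedSobolevNormsOn_holds hν hT'0 hsolc hE hdec

/-- The vorticity equation rearranged: `∂ₜω = (ω·∇)u + νΔω − (u·∇)ω` on `[0, T) × ℝ³`.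
[cite: MajdaBertozziCUP2002, Prop. 2.21 / eq. (2.110)] -/
theorem timeDerivWithin_vorticity_eq (hsol : IsClassicalNSSolutionOn (Ico 0 T) ν 0 u p)
    {t : ℝ} (ht : t ∈ Ico 0 T) (x : EuclideanSpace ℝ (Fin 3)) :
    timeDerivWithin (Ico 0 T) (vorticity u) t x =
      fderiv ℝ (u t) x (curl (u t) x) + ν • (Δ (curl (u t))) x -
        fderiv ℝ (curl (u t)) x (u t x) := by
  have hv := (hsol.isVorticitySolutionOn_Ico fun _ _ y => curl_zero y).vorticity_eq t ht x
  simp only [vorticity_apply, convect] at hv ⊢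
  rw [← hv]
  abel

/-- **Slab bounds**: on `[0, T'] × ℝ³`, `0 < T' < T`, the vorticity and its time derivative (within
`[0, T)`) are bounded, and every vorticity slice is square integrable and Lipschitz.
[cite: Tao2011, Cor. 11.1 (arXiv Cor. 68)] -/
theorem slab_bounds (hν : 0 < ν)
    (hsol : IsClassicalNSSolutionOn (Ico 0 T) ν 0 u p) (hLH : IsLerayHopfOn T ν 0 (u 0) u)
    (hdec : HasRapidSpatialDecay (u 0)) {T' : ℝ} (hT'0 : 0 < T') (hT' : T' < T) :
    ∃ W L D : ℝ, 0 ≤ W ∧ 0 ≤ L ∧ 0 ≤ D ∧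
      (∀ t ∈ Icc 0 T', ∀ x, ‖curl (u t) x‖ ≤ W) ∧
      (∀ t ∈ Icc 0 T', ∀ x, ‖timeDerivWithin (Ico 0 T) (vorticity u) t x‖ ≤ L) ∧
      (∀ t ∈ Icc 0 T', ∀ x, ‖fderiv ℝ (curl (u t)) x‖ ≤ D) ∧
      (∀ t ∈ Icc 0 T', Integrable fun x => ‖curl (u t) x‖ ^ 2) := by
  have hB := hasBoundedSobolevNormsOn_Icc hν hsol hLH hdec hT'0 hT'
  have hsub : Icc 0 T' ⊆ Ico 0 T := Icc_subset_Ico_right hT'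
  have hsm : ∀ t ∈ Icc 0 T', ContDiff ℝ ∞ (u t) := fun t ht => hsol.contDiff_velocity (hsub ht)
  obtain ⟨B₀, hB₀, h₀⟩ := hB.exists_forall_norm_iteratedFDeriv_le hsm 0
  obtain ⟨B₁, hB₁, h₁⟩ := hB.exists_forall_norm_iteratedFDeriv_le hsm 1
  obtain ⟨B₂, hB₂, h₂⟩ := hB.exists_forall_norm_iteratedFDeriv_le hsm 2
  obtain ⟨B₃, hB₃, h₃⟩ := hB.exists_forall_norm_iteratedFDeriv_le hsm 3
  -- pointwise bounds on the slab
  have hu0 : ∀ t ∈ Icc 0 T', ∀ x, ‖u t x‖ ≤ B₀ := fun t ht x => by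
    have := h₀ t ht x; rwa [norm_iteratedFDeriv_zero] at this
  have hDu : ∀ t ∈ Icc 0 T', ∀ x, ‖fderiv ℝ (u t) x‖ ≤ B₁ := fun t ht x => by
    have := h₁ t ht x
    rwa [← norm_iteratedFDeriv_fderiv, norm_iteratedFDeriv_zero] at this
  have hω : ∀ t ∈ Icc 0 T', ∀ x, ‖curl (u t) x‖ ≤ 4 * B₁ := fun t ht x => by
    have h := norm_iteratedFDeriv_curl_le_four_mul (hsm t ht) 0 x
    rw [norm_iteratedFDeriv_zero] at h
    exact h.trans (by linarith [h₁ t ht x])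
  have hDω : ∀ t ∈ Icc 0 T', ∀ x, ‖fderiv ℝ (curl (u t)) x‖ ≤ 4 * B₂ := fun t ht x => by
    have h := norm_iteratedFDeriv_curl_le_four_mul (hsm t ht) 1 x
    rw [← norm_iteratedFDeriv_fderiv, norm_iteratedFDeriv_zero] at h
    exact h.trans (by linarith [h₂ t ht x])
  have hΔω : ∀ t ∈ Icc 0 T', ∀ x, ‖(Δ (curl (u t))) x‖ ≤ 12 * B₃ := fun t ht x => by
    have hc2 : ContDiff ℝ 2 (curl (u t)) :=
      contDiff_curl (n := 2) ((hsm t ht).of_le (by exact_mod_cast le_top))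
    have h := norm_laplacian_le_three_mul_norm_iteratedFDeriv_two hc2 x
    have h' := norm_iteratedFDeriv_curl_le_four_mul (hsm t ht) 2 x
    linarith [h₃ t ht x]
  refine ⟨4 * B₁, B₁ * (4 * B₁) + ν * (12 * B₃) + 4 * B₂ * B₀, 4 * B₂, by positivity,
    by positivity, by positivity, hω, fun t ht x => ?_, hDω, fun t ht => ?_⟩
  · rw [timeDerivWithin_vorticity_eq hsol (hsub ht) x]
    have e1 : ‖fderiv ℝ (u t) x (curl (u t) x)‖ ≤ B₁ * (4 * B₁) :=
      (ContinuousLinearMap.le_opNorm _ _).trans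
        (mul_le_mul (hDu t ht x) (hω t ht x) (norm_nonneg _) hB₁)
    have e2 : ‖ν • (Δ (curl (u t))) x‖ ≤ ν * (12 * B₃) := by
      rw [norm_smul, Real.norm_of_nonneg hν.le]
      exact mul_le_mul_of_nonneg_left (hΔω t ht x) hν.le
    have e3 : ‖fderiv ℝ (curl (u t)) x (u t x)‖ ≤ 4 * B₂ * B₀ :=
      (ContinuousLinearMap.le_opNorm _ _).trans
        (mul_le_mul (hDω t ht x) (hu0 t ht x) (norm_nonneg _) (by positivity))
    exact (norm_sub_le _ _).trans (add_le_add ((norm_add_le _ _).trans (add_le_add e1 e2)) e3)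
  · -- `∫ ‖ω(t)‖² ≤ 16 ∫ ‖D¹u(t)‖² < ∞`
    obtain ⟨C₁, hC₁⟩ := hB 1
    have hcont : Continuous fun x => ‖curl (u t) x‖ ^ 2 :=
      (continuous_curl ((hsm t ht).of_le (by exact_mod_cast le_top))).norm.pow 2
    refine ⟨hcont.aestronglyMeasurable, ?_⟩
    refine (hasFiniteIntegral_iff_enorm.2 ?_)
    have hpt : ∀ x, ‖‖curl (u t) x‖ ^ 2‖ₑ ≤ 16 * ‖iteratedFDeriv ℝ 1 (u t) x‖ₑ ^ 2 := fun x => by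
      have h := norm_iteratedFDeriv_curl_le_four_mul (hsm t ht) 0 x
      rw [norm_iteratedFDeriv_zero] at h
      have e1 : ‖‖curl (u t) x‖ ^ 2‖ₑ = ENNReal.ofReal (‖curl (u t) x‖ ^ 2) :=
        Real.enorm_eq_ofReal (sq_nonneg _)
      have e2 : ‖iteratedFDeriv ℝ 1 (u t) x‖ₑ ^ 2 =
          ENNReal.ofReal (‖iteratedFDeriv ℝ 1 (u t) x‖ ^ 2) := by
        rw [← ofReal_norm, ENNReal.ofReal_pow (norm_nonneg _)]
      rw [e1, e2, show (16 : ℝ≥0∞) * ENNReal.ofReal (‖iteratedFDeriv ℝ 1 (u t) x‖ ^ 2) =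
          ENNReal.ofReal (16 * ‖iteratedFDeriv ℝ 1 (u t) x‖ ^ 2) by
        rw [ENNReal.ofReal_mul (by norm_num), ENNReal.ofReal_ofNat]]
      refine ENNReal.ofReal_le_ofReal ?_
      nlinarith [norm_nonneg (curl (u t) x), norm_nonneg (iteratedFDeriv ℝ 1 (u t) x)]
    calc ∫⁻ x, ‖‖curl (u t) x‖ ^ 2‖ₑ ≤ ∫⁻ x, 16 * ‖iteratedFDeriv ℝ 1 (u t) x‖ₑ ^ 2 :=
          lintegral_mono hpt
      _ = 16 * ∫⁻ x, ‖iteratedFDeriv ℝ 1 (u t) x‖ₑ ^ 2 := by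
          rw [lintegral_const_mul' _ _ (by norm_num)]
      _ ≤ 16 * C₁ := mul_le_mul_right (hC₁ t ht) _
      _ < ⊤ := ENNReal.mul_lt_top (by norm_num) ENNReal.coe_lt_top

/-! ### The maximum of `‖ω(t, ·)‖` is attained -/

/-- **`ω(t, ·) → 0` at spatial infinity** for `t ∈ [0, T)` (Lipschitz and square integrable).
[folklore] -/
theorem tendsto_curl_cocompact (hν : 0 < ν) (hT : 0 < T)
    (hsol : IsClassicalNSSolutionOn (Ico 0 T) ν 0 u p) (hLH : IsLerayHopfOn T ν 0 (u 0) u)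
    (hdec : HasRapidSpatialDecay (u 0)) {t : ℝ} (ht : t ∈ Ico 0 T) :
    Tendsto (curl (u t)) (cocompact _) (𝓝 0) := by
  -- a closed sub-slab containing `t`
  set T' : ℝ := max t (T / 2) with hT'def
  have hT'0 : 0 < T' := lt_max_of_lt_right (by linarith)
  have hT' : T' < T := max_lt ht.2 (by linarith)
  have htI : t ∈ Icc 0 T' := ⟨ht.1, le_max_left _ _⟩
  obtain ⟨W, L, D, -, -, hD, -, -, hDω, hint⟩ := slab_bounds hν hsol hLH hdec hT'0 hT'
  have hdiff : Differentiable ℝ (curl (u t)) :=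
    (contDiff_curl (n := 1) ((hsol.contDiff_velocity ht).of_le (by exact_mod_cast le_top))).differentiable
      (by simp)
  have hlip : LipschitzWith ⟨D, hD⟩ (curl (u t)) :=
    lipschitzWith_of_nnnorm_fderiv_le hdiff fun x => by
      rw [← NNReal.coe_le_coe, coe_nnnorm]; exact hDω t htI x
  exact tendsto_cocompact_of_lipschitzWith_of_integrable_sq hlip (hint t htI)

/-- **The vorticity modulus attains its maximum** on each slice `t ∈ [0, T)`. [folklore] -/
theorem exists_argmax_curl (hν : 0 < ν) (hT : 0 < T)
    (hsol : IsClassicalNSSolutionOn (Ico 0 T) ν 0 u p) (hLH : IsLerayHopfOn T ν 0 (u 0) u)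
    (hdec : HasRapidSpatialDecay (u 0)) {t : ℝ} (ht : t ∈ Ico 0 T) :
    ∃ xm : EuclideanSpace ℝ (Fin 3), ∀ y, ‖curl (u t) y‖ ≤ ‖curl (u t) xm‖ := by
  have hc : Continuous fun y => ‖curl (u t) y‖ :=
    (continuous_curl ((hsol.contDiff_velocity ht).of_le (by exact_mod_cast le_top))).norm
  by_cases h : ∃ x₀, 0 < ‖curl (u t) x₀‖
  · obtain ⟨x₀, hx₀⟩ := h
    refine hc.exists_forall_ge' x₀ ?_
    have h0 := (tendsto_curl_cocompact hν hT hsol hLH hdec ht).norm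
    rw [norm_zero] at h0
    exact (h0.eventually (gt_mem_nhds hx₀)).mono fun y hy => hy.le
  · push Not at h
    refine ⟨0, fun y => ?_⟩
    have hy := h y
    have : ‖curl (u t) y‖ = 0 := le_antisymm hy (norm_nonneg _)
    rw [this]; exact norm_nonneg _

/-! ### The derivative of `‖ω(·, x*)‖²` at a spatial maximiser -/

/-- Along each time line the vorticity has the one-sided derivative `∂ₜω` within `[0, T)`.
[folklore] -/
theorem hasDerivWithinAt_curl (hsol : IsClassicalNSSolutionOn (Ico 0 T) ν 0 u p)
    {t : ℝ} (ht : t ∈ Ico 0 T) (x : EuclideanSpace ℝ (Fin 3)) :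
    HasDerivWithinAt (fun s => curl (u s) x) (timeDerivWithin (Ico 0 T) (vorticity u) t x)
      (Ico 0 T) t := by
  have hω : IsSmoothSpaceTimeOn (Ico 0 T) (vorticity u) :=
    hsol.smooth_velocity.isSmoothSpaceTimeOn_vorticity (uniqueDiffOn_Ico 0 T)
  have h := (hω.differentiableWithinAt_time ht x).hasDerivWithinAt
  simpa only [timeDerivWithin_apply, vorticity_apply] using h

/-- **At a spatial maximiser of `‖ω(t, ·)‖`, `t ∈ (0, T)`**: `s ↦ ‖ω(s, x*)‖²` is differentiable
at `t` with derivative `2⟪ω, ∂ₜω⟫(t, x*) ≤ 2 ⟪ω(t,x*), Du(t,x*) ω(t,x*)⟫` — the transport term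
vanishes (`D‖ω‖² = 0`) and the viscous term is `≤ 0` (`Δ‖ω‖² ≤ 0`) at the maximum.
[cite: Constantin1994, §2 (stretching at vorticity maxima); Lieberman1996, Ch. II Lemma 2.1] -/
theorem deriv_normSq_curl_le_at_argmax (hν : 0 < ν)
    (hsol : IsClassicalNSSolutionOn (Ico 0 T) ν 0 u p)
    {t : ℝ} (ht : t ∈ Ioo 0 T) {xm : EuclideanSpace ℝ (Fin 3)}
    (hmax : ∀ y, ‖curl (u t) y‖ ≤ ‖curl (u t) xm‖) :
    ∃ d : ℝ, HasDerivAt (fun s => ‖curl (u s) xm‖ ^ 2) d t ∧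
      d ≤ 2 * ⟪curl (u t) xm, fderiv ℝ (u t) xm (curl (u t) xm)⟫ := by
  have htI : t ∈ Ico 0 T := ⟨ht.1.le, ht.2⟩
  set w := curl (u t) with hwdef
  set wt := timeDerivWithin (Ico 0 T) (vorticity u) t xm with hwt
  -- the time derivative, two-sided at the interior time `t`
  have hd : HasDerivAt (fun s => curl (u s) xm) wt t :=
    (hasDerivWithinAt_curl hsol htI xm).hasDerivAt (Ico_mem_nhds ht.1 ht.2)
  refine ⟨2 * ⟪w xm, wt⟫, hd.norm_sq, ?_⟩
  -- smoothness of the slice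
  have hu : ContDiff ℝ ∞ (u t) := hsol.contDiff_velocity htI
  have hws : ContDiff ℝ ∞ w := contDiff_curl (n := ⊤) (hu.of_le (by exact_mod_cast le_top))
  have hw2 : ContDiff ℝ 2 w := hws.of_le (by norm_cast)
  have hw1 : ContDiff ℝ 1 w := hws.of_le (by norm_cast)
  -- `xm` is a local maximum of `‖w‖²`
  have hlmax : IsLocalMax (fun y => ⟪w y, w y⟫) xm :=
    Filter.Eventually.of_forall fun y => by
      simp only [real_inner_self_eq_norm_sq]
      exact pow_le_pow_left₀ (norm_nonneg _) (hmax y) 2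
  -- transport term: `⟪w, Dω v⟫ = 0` for every direction `v`
  have htrans : ⟪w xm, fderiv ℝ w xm (u t xm)⟫ = 0 := by
    have hdw : DifferentiableAt ℝ w xm := (hw1.differentiable (by simp)) xm
    have h0 := hlmax.fderiv_eq_zero
    have h1 : fderiv ℝ (fun y => ⟪w y, w y⟫) xm (u t xm) = 0 := by rw [h0]; rfl
    rw [fderiv_inner_apply ℝ hdw hdw, real_inner_comm (w xm)] at h1
    linarith
  -- viscous term: `⟪w, Δw⟫ ≤ 0`
  have hvisc : ⟪w xm, (Δ w) xm⟫ ≤ 0 := by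
    have hΔ := hlmax.laplacian_nonpos (hw2.inner ℝ hw2)
    rw [laplacian_inner_self_eq hw2 xm, real_inner_comm] at hΔ
    linarith [frobeniusNormSq_nonneg (fderiv ℝ w xm)]
  -- the vorticity equation at `(t, xm)`
  have heq : wt = fderiv ℝ (u t) xm (w xm) + ν • (Δ w) xm - fderiv ℝ w xm (u t xm) := by
    rw [hwt, timeDerivWithin_vorticity_eq hsol htI xm]
  rw [heq, inner_sub_right, inner_add_right, real_inner_smul_right, htrans]
  nlinarith [mul_nonpos_of_nonneg_of_nonpos hν.le hvisc]   -- 2(⟪w,Duω⟫ + ν⟪w,Δw⟫ - 0) ≤ 2⟪w,Duω⟫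

/-! ### Continuation from a vorticity sup bound -/

/-- A jointly measurable field on `(0,T) × ℝ³` with `∫∫ ‖f‖^r < ∞` lies in the (guarded) mixed
class `L^r(0,T; L^r)` (Fubini–Tonelli; whole-space twin of the tree's torus lemma
`memLqLp_of_lintegral_lt_top`). [folklore] -/
theorem memLqLp_of_lintegral_lt_top {F : Type*} [NormedAddCommGroup F] {r : ℝ≥0∞} (hr0 : r ≠ 0)
    (hrtop : r ≠ ⊤) {f : ℝ → EuclideanSpace ℝ (Fin 3) → F}
    (hf : AEStronglyMeasurable (uncurry f) ((volume.restrict (Ioo 0 T)).prod volume))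
    (hfin : ∫⁻ t in Ioo 0 T, ∫⁻ x, ‖f t x‖ₑ ^ r.toReal < ⊤) : MemLqLp r r f (Ioo 0 T) := by
  have hslice : ∀ᵐ t ∂(volume.restrict (Ioo 0 T)), AEStronglyMeasurable (f t) volume :=
    hf.prodMk_left
  have hint : AEMeasurable (fun t => ∫⁻ x, ‖f t x‖ₑ ^ r.toReal) (volume.restrict (Ioo 0 T)) :=
    (hf.enorm.pow_const _).lintegral_prod_right'
  have hfin' : ∀ᵐ t ∂(volume.restrict (Ioo 0 T)), ∫⁻ x, ‖f t x‖ₑ ^ r.toReal < ⊤ :=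
    ae_lt_top' hint hfin.ne
  have hmem : ∀ᵐ t ∂(volume.restrict (Ioo 0 T)), MemLp (f t) r volume := by
    filter_upwards [hslice, hfin'] with t h1 h2
    exact ⟨h1, (eLpNorm_lt_top_iff_lintegral_rpow_enorm_lt_top hr0 hrtop).2 h2⟩
  refine ⟨hmem, ?_⟩
  change eLpNorm (fun t => (eLpNorm (f t) r volume).toReal) r (volume.restrict (Ioo 0 T)) < ⊤
  rw [eLpNorm_lt_top_iff_lintegral_rpow_enorm_lt_top hr0 hrtop]
  have hr : 0 < r.toReal := ENNReal.toReal_pos hr0 hrtop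
  have hkey : ∀ᵐ t ∂(volume.restrict (Ioo 0 T)),
      ‖(eLpNorm (f t) r volume).toReal‖ₑ ^ r.toReal = ∫⁻ x, ‖f t x‖ₑ ^ r.toReal := by
    filter_upwards [hmem] with t ht
    rw [Real.enorm_eq_ofReal ENNReal.toReal_nonneg, ENNReal.ofReal_toReal ht.eLpNorm_ne_top,
      eLpNorm_eq_lintegral_rpow_enorm_toReal hr0 hrtop, ← ENNReal.rpow_mul,
      one_div_mul_cancel hr.ne', ENNReal.rpow_one]
  rw [lintegral_congr_ae hkey]
  exact hfin

/-- `y ^ (5/2) ≤ K ^ (1/2) y²` for `0 ≤ y ≤ K`. [folklore] -/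
theorem rpow_five_halves_le {y K : ℝ} (hy : 0 ≤ y) (hyK : y ≤ K) :
    y ^ ((5 : ℝ) / 2) ≤ K ^ ((1 : ℝ) / 2) * y ^ 2 := by
  have h : y ^ ((5 : ℝ) / 2) = y ^ ((1 : ℝ) / 2) * y ^ 2 := by
    rw [show ((5 : ℝ) / 2) = (1 : ℝ) / 2 + 2 by norm_num,
      Real.rpow_add_of_nonneg hy (by norm_num) (by norm_num), Real.rpow_two]
  rw [h]
  exact mul_le_mul_of_nonneg_right (Real.rpow_le_rpow hy hyK (by norm_num)) (sq_nonneg _)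

/-- **Continuation from a uniform vorticity bound.** If `‖ω‖ ≤ K` on `[0, T) × ℝ³` for a classical
Leray–Hopf solution from a rapidly decaying datum (`ν > 0`), the solution extends smoothly past `T`:
`ω ∈ L^{5/2}((0,T) × ℝ³)` by `‖ω‖^{5/2} ≤ K^{1/2}‖ω‖² ≤ 2K^{1/2}|∇u|²` and the energy inequality,
and Beirão da Veiga's vorticity criterion (`2/q + 3/r = 2`, `q = r = 5/2`) applies.
[cite: BeiraoDaVeiga1995, Thm. 1.1 (vorticity form, 2/q + 3/r = 2)] -/
theorem hasSmoothExtensionPast_of_curl_bounded (hν : 0 < ν) (hT : 0 < T)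
    (hsol : IsClassicalNSSolutionOn (Ico 0 T) ν 0 u p) (hLH : IsLerayHopfOn T ν 0 (u 0) u)
    (hdec : HasRapidSpatialDecay (u 0)) {K : ℝ}
    (hK : ∀ t ∈ Ico 0 T, ∀ x, ‖curl (u t) x‖ ≤ K) :
    HasSmoothExtensionPast ν 0 u T := by
  have hK0 : 0 ≤ K := (norm_nonneg _).trans (hK 0 ⟨le_rfl, hT⟩ 0)
  have h52 : (5 / 2 : ℝ≥0∞) = ENNReal.ofReal (5 / 2) := by
    rw [ENNReal.ofReal_div_of_pos (by norm_num : (0 : ℝ) < 2), ENNReal.ofReal_ofNat,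
      ENNReal.ofReal_ofNat]
  have hr0 : (5 / 2 : ℝ≥0∞) ≠ 0 := by rw [h52]; exact (ENNReal.ofReal_pos.2 (by norm_num)).ne'
  have hrtop : (5 / 2 : ℝ≥0∞) ≠ ⊤ := by rw [h52]; exact ENNReal.ofReal_ne_top
  have hrreal : (5 / 2 : ℝ≥0∞).toReal = (5 : ℝ) / 2 := by
    rw [h52, ENNReal.toReal_ofReal (by norm_num)]
  have h1r : 1 < (5 / 2 : ℝ≥0∞) := by
    rw [h52, ← ENNReal.ofReal_one]; exact (ENNReal.ofReal_lt_ofReal_iff (by norm_num)).2 (by norm_num)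
  have hexp : 2 / (5 / 2 : ℝ≥0∞) + 3 / (5 / 2 : ℝ≥0∞) = 2 := by
    rw [h52, show (2 : ℝ≥0∞) = ENNReal.ofReal 2 from (ENNReal.ofReal_ofNat 2).symm,
      show (3 : ℝ≥0∞) = ENNReal.ofReal 3 from (ENNReal.ofReal_ofNat 3).symm,
      ← ENNReal.ofReal_div_of_pos (by norm_num), ← ENNReal.ofReal_div_of_pos (by norm_num),
      ← ENNReal.ofReal_add (by norm_num) (by norm_num)]
    norm_num
  refine BeiraoDaVeiga1995_vorticityCriterion ν T hν hT u p hsol hLH hdec (5 / 2) (5 / 2) h1r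
    hrtop.lt_top hexp ?_
  -- `ω ∈ L^{5/2}_{t,x}`
  refine memLqLp_of_lintegral_lt_top hr0 hrtop ?_ ?_
  · -- joint measurability from joint continuity of the vorticity
    have hω : IsSmoothSpaceTimeOn (Ico 0 T) (vorticity u) :=
      hsol.smooth_velocity.isSmoothSpaceTimeOn_vorticity (uniqueDiffOn_Ico 0 T)
    have hc : ContinuousOn (uncurry fun t x => curl (u t) x) (Ioo 0 T ×ˢ univ) :=
      hω.continuousOn.mono (prod_mono Ioo_subset_Ico_self Subset.rfl)
    rw [Measure.restrict_prod_eq_prod_univ]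
    exact hc.aestronglyMeasurable (measurableSet_Ioo.prod MeasurableSet.univ)
  · -- `∫∫ ‖ω‖^{5/2} ≤ 2 K^{1/2} ∫∫ |∇u|² < ∞`
    obtain ⟨hgrad, -⟩ := hLH.lintegral_frobeniusNormSq_fderiv_of_classical hsol hT
    rw [hrreal]
    have hpt : ∀ t ∈ Ioo 0 T, ∀ x, ‖curl (u t) x‖ₑ ^ ((5 : ℝ) / 2) ≤
        ENNReal.ofReal (2 * K ^ ((1 : ℝ) / 2)) *
          ENNReal.ofReal (frobeniusNormSq (fderiv ℝ (u t) x)) := by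
      intro t ht x
      rw [← ofReal_norm, ENNReal.ofReal_rpow_of_nonneg (norm_nonneg _) (by norm_num),
        ← ENNReal.ofReal_mul (by positivity)]
      refine ENNReal.ofReal_le_ofReal ?_
      have h1 := rpow_five_halves_le (norm_nonneg (curl (u t) x)) (hK t (Ioo_subset_Ico_self ht) x)
      have h2 := norm_curl_sq_le_two_mul_frobeniusNormSq (u t) x
      have h3 : 0 ≤ K ^ ((1 : ℝ) / 2) := Real.rpow_nonneg hK0 _
      nlinarith [mul_le_mul_of_nonneg_left h2 h3]
    calc ∫⁻ t in Ioo 0 T, ∫⁻ x, ‖curl (u t) x‖ₑ ^ ((5 : ℝ) / 2)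
        ≤ ∫⁻ t in Ioo 0 T, ∫⁻ x, ENNReal.ofReal (2 * K ^ ((1 : ℝ) / 2)) *
            ENNReal.ofReal (frobeniusNormSq (fderiv ℝ (u t) x)) := by
          refine setLIntegral_mono' measurableSet_Ioo fun t ht => lintegral_mono fun x => hpt t ht x
      _ = ENNReal.ofReal (2 * K ^ ((1 : ℝ) / 2)) *
            ∫⁻ t in Ioo 0 T, ∫⁻ x, ENNReal.ofReal (frobeniusNormSq (fderiv ℝ (u t) x)) := by
          rw [← lintegral_const_mul' _ _ ENNReal.ofReal_ne_top]
          congr 1; funext t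
          rw [lintegral_const_mul' _ _ ENNReal.ofReal_ne_top]
      _ < ⊤ := ENNReal.mul_lt_top ENNReal.ofReal_lt_top hgrad.lt_top

end StretchingAtMax

end Summit.NavierStokesRegularity.NavierStokesRegularity.Theorems

end
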